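import Summits.CriticalPhenomena.PercolationContinuityZ3.Theorems.Transplant.SkelFrmQuasiBParamsFaceCountsShiftA
import Summits.CriticalPhenomena.PercolationContinuityZ3.Theorems.Transplant.SkelFrmBParamsFaceCountsShiftA
import Summits.CriticalPhenomena.PercolationContinuityZ3.Theorems.Transplant.SkelFrmQuasiBParamsFaceFloorsClrXA
import Summits.CriticalPhenomena.PercolationContinuityZ3.Theorems.Transplant.SkelFrmBParamsFaceFloorsClrXA
import Summits.CriticalPhenomena.PercolationContinuityZ3.Theorems.Transplant.SkelFrmQuasiBParamsFaceTop
import Summits.CriticalPhenomena.PercolationContinuityZ3.Theorems.Transplant.SkelFrmBParamsFaceTop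
import Summits.CriticalPhenomena.PercolationContinuityZ3.Theorems.Transplant.SkelPhiFaceNumsCross
import Summits.CriticalPhenomena.PercolationContinuityZ3.Theorems.Transplant.PlanarSkeletonFrmQuasiDefs
import Summits.CriticalPhenomena.PercolationContinuityZ3.Theorems.Transplant.PlanarSkeletonFrmDefs
import Summits.CriticalPhenomena.PercolationContinuityZ3.Theorems.Transplant.SkelPhiStepIDataNS
import Summits.CriticalPhenomena.PercolationContinuityZ3.Theorems.Transplant.SkelFrmQuasi1ParamsLBL
import Summits.CriticalPhenomena.PercolationContinuityZ3.Theorems.Transplant.SkelFrmQuasiBParamsFaceUnits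
import Summits.CriticalPhenomena.PercolationContinuityZ3.Theorems.Transplant.SkelFrmQuasiBParamsLF
import Summits.CriticalPhenomena.PercolationContinuityZ3.Theorems.Transplant.SkelFrmQuasiBParamsLFA
import HarnessLib
import Summits.CriticalPhenomena.PercolationContinuityZ3.Theorems.Transplant.SkelFrmBParamsFaceCountsShiftYA
/-!
# GEN-Q PORT (WAVE-Q table v0.8 section 2, row G181, U-level L19; captain R-6/R-7 2026-08-27: carrier token swap `PlanarSkeletonFrmFrom ↦ PlanarSkeletonFrmQuasi`)
# of the tree module «Transplant/SkelFrmFromBParamsFaceCountsShiftYA» (sha256 35267a32a888ecfe…) onto the quasi-step carrier `PlanarSkeletonFrmQuasi` (p507026): «SkelFrmQuasiBParamsFaceCountsShiftYA»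

ORIGINAL TITLE: (F) VALUE LAYER, N2 twin (hp-8 g42, 2026-08-23; F-DISCHARGE-MAP-N2 G18): `port_frm.py` text of N1 `SkelNegBParamsFaceCountsShiftYA` (hp-8 g36) over

builds on p205010 (kernel theorem, internal audit signed; external expert review pending) — nothing in this file uses p205010; NOTHING is claimed about any open node
((N3-b), the end state).  Lane `prim-bschramm`, seat `prim-bschramm-stmt` (gen 33; GEN-Q column pen; tool = captain gen-1 g4's port_genq.py R-14 --cone + p3-g30's T1 patch).  Helper file (`--supports stmt-CriticalPhenomena-4575 --as helper`).
PORT RULES (U-wave r1–r4 re-used, GEN-Q hunk classes of p3-g29 #6136): declaration order, names and proof texts are those of «SkelFrmFromBParamsFaceCountsShiftYA», byte-identical except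
(i) the carrier token `PlanarSkeletonFrmFrom ↦ PlanarSkeletonFrmQuasi` in binders, `namespace`/`end` lines and qualified names (module names `SkelFrmFrom… ↦ SkelFrmQuasi…`
in imports of already-ported rows); (ii) `Φ.step ↦ Φ.qstep` with the called Steps lemma replaced by its `…Q`/`_q` twin and the cost `Φ.M` threaded (none in this file unless
listed below); (iii) `Φ.cyl_connected ↦ Φ.cyl_reach` readers (none unless listed); (iv) graph-ball radii / window floors ×`Φ.M` (none unless listed).  Carrier-free
residents stay imported/exported from the original «SkelFrmBParamsFaceCountsShiftYA» exactly as in the FrmFrom port.  Docstrings and citations are the original's.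

-/

noncomputable section

open scoped Classical

namespace Summit.CriticalPhenomena.PercolationContinuityZ3.Theorems.Transplant

namespace PlanarSkeletonFrmQuasi

namespace NegB

open Literature.Probability.Percolation Literature.Probability.LatticeModels SimpleGraph
open SkelConc (Consts)
open Skelφ (shearUnit)
open Skelφ.StepI (DataN)
open TwoAxis.Para (modulus)
open Neg

namespace KS

section ShiftY

/-- The y′-run's cross offset moves `Λ₁` by `n_L·Y − h_L·X` (`(X, Y)` the offset's components). [folklore] -/
theorem Λ₁of_crossOffY (κ : Consts) {V : Type} [DecidableEq V] [Countable V] {G : SimpleGraph V} [G.LocallyFinite] (Φ : PlanarSkeletonFrmQuasi G) (t : V) (p : unitInterval) (D : Skelφ.StepI.DataNS V) (g : ℕ) (f : ℕ) (yL : Site 2) (σ : ℤ) (Nr : ℕ) :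
    Λ₁of κ Φ t p D g f (yL + (Skelφ.crossOffY (nL κ Φ t p D g f) (ℓL κ Φ t p D g f) (hL κ Φ t p D g f) (vL κ Φ t p D g f) σ Nr)) - Λ₁of κ Φ t p D g f yL = ((nL κ Φ t p D g f) : ℤ) * (Skelφ.crossOffY (nL κ Φ t p D g f) (ℓL κ Φ t p D g f) (hL κ Φ t p D g f) (vL κ Φ t p D g f) σ Nr) 1 - (hL κ Φ t p D g f) * (Skelφ.crossOffY (nL κ Φ t p D g f) (ℓL κ Φ t p D g f) (hL κ Φ t p D g f) (vL κ Φ t p D g f) σ Nr) 0 := by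
  unfold Λ₁of; simp only [Pi.add_apply]; ring

/-- The y′-run's cross offset moves `Λ₀` by `v_β·X − v_L·Y`. [folklore] -/
theorem Λ₀of_crossOffY (κ : Consts) {V : Type} [DecidableEq V] [Countable V] {G : SimpleGraph V} [G.LocallyFinite] (Φ : PlanarSkeletonFrmQuasi G) (t : V) (p : unitInterval) (D : Skelφ.StepI.DataNS V) (g : ℕ) (f : ℕ) (yL : Site 2) (σ : ℤ) (Nr : ℕ) :
    Λ₀of κ Φ t p D g f (yL + (Skelφ.crossOffY (nL κ Φ t p D g f) (ℓL κ Φ t p D g f) (hL κ Φ t p D g f) (vL κ Φ t p D g f) σ Nr)) - Λ₀of κ Φ t p D g f yL = (vβL κ Φ t p D g f) * (Skelφ.crossOffY (nL κ Φ t p D g f) (ℓL κ Φ t p D g f) (hL κ Φ t p D g f) (vL κ Φ t p D g f) σ Nr) 0 - (vL κ Φ t p D g f) * (Skelφ.crossOffY (nL κ Φ t p D g f) (ℓL κ Φ t p D g f) (hL κ Φ t p D g f) (vL κ Φ t p D g f) σ Nr) 1 := by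
  unfold Λ₀of vβL; simp only [Pi.add_apply]; ring

/-- **The region level step against the modulus**: `0 ≤ m − U·s_lo ≤ 2U − 2` with `s_lo = ⌊(n_Lℓ_L − U + 1)/U⌋`. [folklore] -/
theorem sLoU_bounds (κ : Consts) {V : Type} [DecidableEq V] [Countable V] {G : SimpleGraph V} [G.LocallyFinite] (Φ : PlanarSkeletonFrmQuasi G) (t : V) (p : unitInterval) (D : Skelφ.StepI.DataNS V) (g : ℕ) (f : ℕ) (hN : EqNumL κ Φ t p D g f) (hκ : ((hL κ Φ t p D g f)).natAbs ≤ 10 * nL κ Φ t p D g f) :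
    0 ≤ (modulus (nL κ Φ t p D g f) (hL κ Φ t p D g f) (vL κ Φ t p D g f) (vβL κ Φ t p D g f)) - (shearUnit (nL κ Φ t p D g f) (hL κ Φ t p D g f) : ℤ) * ((((nL κ Φ t p D g f) : ℤ) * (ℓL κ Φ t p D g f) - (shearUnit (nL κ Φ t p D g f) (hL κ Φ t p D g f) : ℕ) + 1) / (shearUnit (nL κ Φ t p D g f) (hL κ Φ t p D g f) : ℕ)) ∧
      (modulus (nL κ Φ t p D g f) (hL κ Φ t p D g f) (vL κ Φ t p D g f) (vβL κ Φ t p D g f)) - (shearUnit (nL κ Φ t p D g f) (hL κ Φ t p D g f) : ℤ) * ((((nL κ Φ t p D g f) : ℤ) * (ℓL κ Φ t p D g f) - (shearUnit (nL κ Φ t p D g f) (hL κ Φ t p D g f) : ℕ) + 1) / (shearUnit (nL κ Φ t p D g f) (hL κ Φ t p D g f) : ℕ)) ≤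
        2 * (shearUnit (nL κ Φ t p D g f) (hL κ Φ t p D g f) : ℤ) - 2 := by
  obtain ⟨hn1, -⟩ := one_le_of_eqNumL κ Φ t p D g f hN
  obtain ⟨hU1, -⟩ := clr_shearUnit_bounds κ Φ t p D g f hκ
  obtain ⟨hmlo, hmhi⟩ := modulus_top κ Φ t p D g f hn1
  have hn1' : (1 : ℤ) ≤ (nL κ Φ t p D g f) := by exact_mod_cast hn1
  have hU : (0 : ℤ) < (shearUnit (nL κ Φ t p D g f) (hL κ Φ t p D g f) : ℤ) := by linarith
  obtain ⟨f1, f2⟩ := PlanarSkeletonNeg.NegB.RootArith.floor_sandwich (x := ((nL κ Φ t p D g f) : ℤ) * (ℓL κ Φ t p D g f) - (shearUnit (nL κ Φ t p D g f) (hL κ Φ t p D g f) : ℕ) + 1) (d := (shearUnit (nL κ Φ t p D g f) (hL κ Φ t p D g f) : ℤ)) hU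
  constructor
  · linarith
  · linarith

/-- **`u₁·U ≤ m`** (`u₁ = ⌊m/U⌋ − 1`, `U = n_L + |h_L|`). [folklore] -/
theorem u₁_mul_U_le (κ : Consts) {V : Type} [DecidableEq V] [Countable V] {G : SimpleGraph V} [G.LocallyFinite] (Φ : PlanarSkeletonFrmQuasi G) (t : V) (p : unitInterval) (D : Skelφ.StepI.DataNS V) (g : ℕ) (f : ℕ) (hN : EqNumL κ Φ t p D g f) : u₁A κ Φ t p D g f * (shearUnit (nL κ Φ t p D g f) (hL κ Φ t p D g f) : ℤ) ≤ (modulus (nL κ Φ t p D g f) (hL κ Φ t p D g f) (vL κ Φ t p D g f) (vβL κ Φ t p D g f)) ∧ 0 ≤ u₁A κ Φ t p D g f := by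
  obtain ⟨hn1, hℓ1⟩ := one_le_of_eqNumL κ Φ t p D g f hN
  have hn1' : (1 : ℤ) ≤ (nL κ Φ t p D g f) := by exact_mod_cast hn1
  have hm : 0 < (modulus (nL κ Φ t p D g f) (hL κ Φ t p D g f) (vL κ Φ t p D g f) (vβL κ Φ t p D g f)) := Skelφ.NegPrm.modulus_vβOf_pos hn1 hℓ1 _ _
  have hu : u₁A κ Φ t p D g f = fm1A κ Φ t p D g f := by unfold u₁A; exact (fcellsA_s_at κ Φ t p D g f hN).2
  have hu1 : 1 ≤ u₁A κ Φ t p D g f := (units_eqA κ Φ t p D g f).2.2.2.2.2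
  have e : fm1A κ Φ t p D g f = (modulus (nL κ Φ t p D g f) (hL κ Φ t p D g f) (vL κ Φ t p D g f) (vβL κ Φ t p D g f)) / (((nL κ Φ t p D g f) : ℤ) + |(hL κ Φ t p D g f)|) - 1 := by
    unfold fm1A; rw [(mA_eq κ Φ t p D g f).2]; rfl
  have eU : (shearUnit (nL κ Φ t p D g f) (hL κ Φ t p D g f) : ℤ) = ((nL κ Φ t p D g f) : ℤ) + |(hL κ Φ t p D g f)| := by unfold Skelφ.shearUnit; push_cast [Int.natCast_natAbs]; ring
  refine ⟨?_, by linarith⟩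
  rw [hu, e, eU]
  have ha : 0 ≤ |(hL κ Φ t p D g f)| := abs_nonneg _
  set m := (modulus (nL κ Φ t p D g f) (hL κ Φ t p D g f) (vL κ Φ t p D g f) (vβL κ Φ t p D g f))
  set L := ((nL κ Φ t p D g f) : ℤ) + |(hL κ Φ t p D g f)|
  have h1 : L * (m / L) ≤ m := Int.mul_ediv_self_le (by linarith)
  nlinarith

/-- **THE y′-RUN ADVANCES THE ORDINATE READING BY `u₁` PER REGION, UP TO `2(N_r+1) + 2`**: `|F1cA yT − F1cA yL − σ·u₁·(N_r+1)| ≤ 2(N_r+1) + 2`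
for `yT := yL + crossOffY n_L ℓ_L h_L v_L σ N_r`, `σ = ±1`. [folklore] -/
theorem F1cA_crossOffY_sub_abs_le (κ : Consts) {V : Type} [DecidableEq V] [Countable V] {G : SimpleGraph V} [G.LocallyFinite] (Φ : PlanarSkeletonFrmQuasi G) (t : V) (p : unitInterval) (D : Skelφ.StepI.DataNS V) (g : ℕ) (f : ℕ) (hN : EqNumL κ Φ t p D g f) (hκ : ((hL κ Φ t p D g f)).natAbs ≤ 10 * nL κ Φ t p D g f) (yL : Site 2) {σ : ℤ} (hσ : σ = 1 ∨ σ = -1)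
    (Nr : ℕ) :
    |F1cA κ Φ t p D g f (yL + (Skelφ.crossOffY (nL κ Φ t p D g f) (ℓL κ Φ t p D g f) (hL κ Φ t p D g f) (vL κ Φ t p D g f) σ Nr)) - F1cA κ Φ t p D g f yL - σ * u₁A κ Φ t p D g f * ((Nr : ℤ) + 1)| ≤ 2 * ((Nr : ℤ) + 1) + 2 := by
  obtain ⟨hn1, hℓ1⟩ := one_le_of_eqNumL κ Φ t p D g f hN
  have hn0 : (0 : ℤ) < (nL κ Φ t p D g f) := by exact_mod_cast hn1
  have hm : 0 < (modulus (nL κ Φ t p D g f) (hL κ Φ t p D g f) (vL κ Φ t p D g f) (vβL κ Φ t p D g f)) := Skelφ.NegPrm.modulus_vβOf_pos hn1 hℓ1 _ _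
  obtain ⟨hwU, hw0⟩ := u₁_mul_U_le κ Φ t p D g f hN
  obtain ⟨hwn, -⟩ := u₁_mul_nL_le κ Φ t p D g f hN
  obtain ⟨hε0, hε1⟩ := sLoU_bounds κ Φ t p D g f hN hκ
  obtain ⟨hU1, hU2⟩ := clr_shearUnit_bounds κ Φ t p D g f hκ
  rw [F1cA_eq, F1cA_eq]
  have hΔ := Λ₁of_crossOffY κ Φ t p D g f yL σ Nr
  have hX : (Skelφ.crossOffY (nL κ Φ t p D g f) (ℓL κ Φ t p D g f) (hL κ Φ t p D g f) (vL κ Φ t p D g f) σ Nr) 0 = σ * (((Nr : ℤ) + 1) * (vL κ Φ t p D g f)) := by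
    simp only [Skelφ.crossOffY, Skelφ.pt_zero]
  have hY : (Skelφ.crossOffY (nL κ Φ t p D g f) (ℓL κ Φ t p D g f) (hL κ Φ t p D g f) (vL κ Φ t p D g f) σ Nr) 1 = (σ * (((Nr : ℤ) + 1) * ((((nL κ Φ t p D g f) : ℤ) * (ℓL κ Φ t p D g f) - (shearUnit (nL κ Φ t p D g f) (hL κ Φ t p D g f) : ℕ) + 1) / (shearUnit (nL κ Φ t p D g f) (hL κ Φ t p D g f) : ℕ))) * (shearUnit (nL κ Φ t p D g f) (hL κ Φ t p D g f) : ℤ) +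
      (hL κ Φ t p D g f) * (σ * (((Nr : ℤ) + 1) * (vL κ Φ t p D g f)))) / ((nL κ Φ t p D g f) : ℤ) := by
    simp only [Skelφ.crossOffY, Skelφ.pt_one]
  set m := (modulus (nL κ Φ t p D g f) (hL κ Φ t p D g f) (vL κ Φ t p D g f) (vβL κ Φ t p D g f)) with hmdef
  set w := u₁A κ Φ t p D g f
  set n : ℤ := ((nL κ Φ t p D g f) : ℤ)
  set h := (hL κ Φ t p D g f)
  set v := (vL κ Φ t p D g f)
  set U : ℤ := (shearUnit (nL κ Φ t p D g f) (hL κ Φ t p D g f) : ℤ) with hUdef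
  set sLo : ℤ := ((((nL κ Φ t p D g f) : ℤ) * (ℓL κ Φ t p D g f) - (shearUnit (nL κ Φ t p D g f) (hL κ Φ t p D g f) : ℕ) + 1) / (shearUnit (nL κ Φ t p D g f) (hL κ Φ t p D g f) : ℕ))
  have hNr0 : (0 : ℤ) ≤ (Nr : ℤ) := Nat.cast_nonneg _
  set N : ℤ := (Nr : ℤ) + 1 with hNdef
  set Λ' := Λ₁of κ Φ t p D g f (yL + (Skelφ.crossOffY (nL κ Φ t p D g f) (ℓL κ Φ t p D g f) (hL κ Φ t p D g f) (vL κ Φ t p D g f) σ Nr))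
  set Λ := Λ₁of κ Φ t p D g f yL
  -- `n·Y = A − r`, `0 ≤ r < n`
  obtain ⟨q1, q2⟩ := PlanarSkeletonNeg.NegB.RootArith.floor_sandwich (x := σ * (N * sLo) * U + h * (σ * (N * v))) (d := n) hn0
  set Y := (σ * (N * sLo) * U + h * (σ * (N * v))) / n
  have hΔ' : Λ' - Λ = n * Y - h * (σ * (N * v)) := by rw [hΔ, hX, hY]
  -- `ΔΛ₁ − σ N m = −σ N ε − r` with `ε = m − U sLo`, `r = A − nY`
  have hN0 : 0 ≤ N := by rw [hNdef]; linarith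
  have hσabs : |σ| = 1 := by rcases hσ with hs | hs <;> simp [hs]
  have key : |(Λ' - Λ) - σ * N * m| ≤ N * (2 * U - 2) + n := by
    have e : (Λ' - Λ) - σ * N * m = -(σ * (N * (m - U * sLo))) - ((σ * (N * sLo) * U + h * (σ * (N * v))) - n * Y) := by
      rw [hΔ']; ring
    rw [e]
    calc |-(σ * (N * (m - U * sLo))) - ((σ * (N * sLo) * U + h * (σ * (N * v))) - n * Y)|
        ≤ |-(σ * (N * (m - U * sLo)))| + |(σ * (N * sLo) * U + h * (σ * (N * v))) - n * Y| := abs_sub _ _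
      _ ≤ N * (2 * U - 2) + n := by
          rw [abs_neg, abs_mul, hσabs, one_mul, abs_of_nonneg (mul_nonneg hN0 hε0), abs_of_nonneg (by linarith)]
          have : N * (m - U * sLo) ≤ N * (2 * U - 2) := mul_le_mul_of_nonneg_left hε1 hN0
          linarith
  -- pass to the readings: numerators differ by `2w·(ΔΛ₁)`; split off the exact multiple `σ w N · (2m)`
  have e1 : 2 * w * Λ' + m = (2 * w * Λ + m + 2 * w * ((Λ' - Λ) - σ * N * m)) + (σ * w * N) * (2 * m) := by ring
  rw [e1, Int.add_mul_ediv_right _ _ (by linarith : (2 : ℤ) * m ≠ 0)]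
  have hc : |(2 * w * Λ + m + 2 * w * ((Λ' - Λ) - σ * N * m)) - (2 * w * Λ + m)| ≤ (2 * N + 1) * (2 * m) := by
    have e2 : (2 * w * Λ + m + 2 * w * ((Λ' - Λ) - σ * N * m)) - (2 * w * Λ + m) = 2 * (w * ((Λ' - Λ) - σ * N * m)) := by ring
    rw [e2, abs_mul, abs_of_pos (by norm_num : (0:ℤ) < 2), abs_mul, abs_of_nonneg hw0]
    have h1 : w * |(Λ' - Λ) - σ * N * m| ≤ w * (N * (2 * U - 2) + n) := mul_le_mul_of_nonneg_left key hw0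
    have h2 : (2 * N) * (w * U) ≤ (2 * N) * m := mul_le_mul_of_nonneg_left hwU (by linarith)
    have h3 : w * n ≤ m := hwn
    have h4 : 0 ≤ N * w := mul_nonneg hN0 hw0
    linarith
  have := ediv_sub_ediv_abs_le (by linarith : (0:ℤ) < 2 * m) hc
  have e3 : (2 * w * Λ + m + 2 * w * ((Λ' - Λ) - σ * N * m)) / (2 * m) + σ * w * N - (2 * w * Λ + m) / (2 * m) - σ * w * ((Nr : ℤ) + 1) =
      (2 * w * Λ + m + 2 * w * ((Λ' - Λ) - σ * N * m)) / (2 * m) - (2 * w * Λ + m) / (2 * m) := by ring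
  rw [e3]
  linarith

set_option maxHeartbeats 800000 in
/-- **THE y′-RUN'S CROSS OFFSET MOVES THE ABSCISSA READING BY AT MOST `u₀`**: `|FcA yT − FcA yL| ≤ u₀` for `yT := yL + crossOffY … σ N_r`,
`σ = ±1`, as soon as `25(N_r+1) + 13 ≤ ℓ_L` and `11 ≤ u₀`. [folklore] -/
theorem FcA_crossOffY_sub_abs_le (κ : Consts) {V : Type} [DecidableEq V] [Countable V] {G : SimpleGraph V} [G.LocallyFinite] (Φ : PlanarSkeletonFrmQuasi G) (t : V) (p : unitInterval) (D : Skelφ.StepI.DataNS V) (g : ℕ) (f : ℕ) (hN : EqNumL κ Φ t p D g f) (hκ : ((hL κ Φ t p D g f)).natAbs ≤ 10 * nL κ Φ t p D g f) (yL : Site 2) {σ : ℤ} (hσ : σ = 1 ∨ σ = -1)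
    (Nr : ℕ) (hℓN : 25 * ((Nr : ℤ) + 1) + 13 ≤ ((ℓL κ Φ t p D g f) : ℤ)) (hu11 : 11 ≤ u₀A κ Φ t p D g f) :
    |FcA κ Φ t p D g f (yL + (Skelφ.crossOffY (nL κ Φ t p D g f) (ℓL κ Φ t p D g f) (hL κ Φ t p D g f) (vL κ Φ t p D g f) σ Nr)) - FcA κ Φ t p D g f yL| ≤ u₀A κ Φ t p D g f := by
  obtain ⟨hn1, hℓ1⟩ := one_le_of_eqNumL κ Φ t p D g f hN
  have hn0 : (0 : ℤ) < (nL κ Φ t p D g f) := by exact_mod_cast hn1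
  have hm : 0 < (modulus (nL κ Φ t p D g f) (hL κ Φ t p D g f) (vL κ Φ t p D g f) (vβL κ Φ t p D g f)) := Skelφ.NegPrm.modulus_vβOf_pos hn1 hℓ1 _ _
  obtain ⟨huL, hu0⟩ := u₀_mul_L0hat_le κ Φ t p D g f hN
  obtain ⟨hε0, hε1⟩ := sLoU_bounds κ Φ t p D g f hN hκ
  obtain ⟨hU1, hU2⟩ := clr_shearUnit_bounds κ Φ t p D g f hκ
  obtain ⟨hmlo, -⟩ := modulus_top κ Φ t p D g f hn1
  have hv := hN.v_le
  rw [FcA_eq, FcA_eq]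
  have hΔ := Λ₀of_crossOffY κ Φ t p D g f yL σ Nr
  have hX : (Skelφ.crossOffY (nL κ Φ t p D g f) (ℓL κ Φ t p D g f) (hL κ Φ t p D g f) (vL κ Φ t p D g f) σ Nr) 0 = σ * (((Nr : ℤ) + 1) * (vL κ Φ t p D g f)) := by
    simp only [Skelφ.crossOffY, Skelφ.pt_zero]
  have hY : (Skelφ.crossOffY (nL κ Φ t p D g f) (ℓL κ Φ t p D g f) (hL κ Φ t p D g f) (vL κ Φ t p D g f) σ Nr) 1 = (σ * (((Nr : ℤ) + 1) * ((((nL κ Φ t p D g f) : ℤ) * (ℓL κ Φ t p D g f) - (shearUnit (nL κ Φ t p D g f) (hL κ Φ t p D g f) : ℕ) + 1) / (shearUnit (nL κ Φ t p D g f) (hL κ Φ t p D g f) : ℕ))) * (shearUnit (nL κ Φ t p D g f) (hL κ Φ t p D g f) : ℤ) +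
      (hL κ Φ t p D g f) * (σ * (((Nr : ℤ) + 1) * (vL κ Φ t p D g f)))) / ((nL κ Φ t p D g f) : ℤ) := by
    simp only [Skelφ.crossOffY, Skelφ.pt_one]
  set m := (modulus (nL κ Φ t p D g f) (hL κ Φ t p D g f) (vL κ Φ t p D g f) (vβL κ Φ t p D g f)) with hmdef
  set u := u₀A κ Φ t p D g f
  set n : ℤ := ((nL κ Φ t p D g f) : ℤ)
  set h := (hL κ Φ t p D g f)
  set v := (vL κ Φ t p D g f)
  set vβ := (vβL κ Φ t p D g f)
  set U : ℤ := (shearUnit (nL κ Φ t p D g f) (hL κ Φ t p D g f) : ℤ) with hUdef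
  set sLo : ℤ := ((((nL κ Φ t p D g f) : ℤ) * (ℓL κ Φ t p D g f) - (shearUnit (nL κ Φ t p D g f) (hL κ Φ t p D g f) : ℕ) + 1) / (shearUnit (nL κ Φ t p D g f) (hL κ Φ t p D g f) : ℕ))
  have hNr0 : (0 : ℤ) ≤ (Nr : ℤ) := Nat.cast_nonneg _
  set N : ℤ := (Nr : ℤ) + 1 with hNdef
  set Λ' := Λ₀of κ Φ t p D g f (yL + (Skelφ.crossOffY (nL κ Φ t p D g f) (ℓL κ Φ t p D g f) (hL κ Φ t p D g f) (vL κ Φ t p D g f) σ Nr))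
  set Λ := Λ₀of κ Φ t p D g f yL
  obtain ⟨q1, q2⟩ := PlanarSkeletonNeg.NegB.RootArith.floor_sandwich (x := σ * (N * sLo) * U + h * (σ * (N * v))) (d := n) hn0
  set Y := (σ * (N * sLo) * U + h * (σ * (N * v))) / n
  have hΔ' : Λ' - Λ = vβ * (σ * (N * v)) - v * Y := by rw [hΔ, hX, hY]
  have hN0 : 0 ≤ N := by rw [hNdef]; linarith
  have hN1 : 1 ≤ N := by rw [hNdef]; linarith
  have hσabs : |σ| = 1 := by rcases hσ with hs | hs <;> simp [hs]
  obtain ⟨hv1, hv2⟩ := abs_le.1 hv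
  -- `n·ΔΛ₀ = σ N v ε + v r`
  have hnΔ : n * (Λ' - Λ) = σ * (N * v) * (m - U * sLo) + v * ((σ * (N * sLo) * U + h * (σ * (N * v))) - n * Y) := by
    rw [hΔ', hmdef]; unfold TwoAxis.Para.modulus; ring
  have key : n * |Λ' - Λ| ≤ n * (N * (2 * U - 2) + n) := by
    have e1 : n * |Λ' - Λ| = |n * (Λ' - Λ)| := by rw [abs_mul, abs_of_pos hn0]
    rw [e1, hnΔ]
    have hv0 : 0 ≤ |v| := abs_nonneg v
    have t1 : |σ * (N * v) * (m - U * sLo)| ≤ N * n * (2 * U - 2) := by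
      rw [abs_mul, abs_mul, hσabs, one_mul, abs_mul, abs_of_nonneg hN0, abs_of_nonneg hε0]
      calc N * |v| * (m - U * sLo) ≤ N * n * (m - U * sLo) :=
            mul_le_mul_of_nonneg_right (mul_le_mul_of_nonneg_left hv hN0) hε0
        _ ≤ N * n * (2 * U - 2) := mul_le_mul_of_nonneg_left hε1 (mul_nonneg hN0 hn0.le)
    have t2 : |v * ((σ * (N * sLo) * U + h * (σ * (N * v))) - n * Y)| ≤ n * n := by
      rw [abs_mul, abs_of_nonneg (by linarith : (0:ℤ) ≤ (σ * (N * sLo) * U + h * (σ * (N * v))) - n * Y)]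
      exact mul_le_mul hv (by linarith) (by linarith) hn0.le
    have := abs_add_le (σ * (N * v) * (m - U * sLo)) (v * ((σ * (N * sLo) * U + h * (σ * (N * v))) - n * Y))
    nlinarith
  have key' : |Λ' - Λ| ≤ N * (2 * U - 2) + n := le_of_mul_le_mul_left key hn0
  -- `u·|ΔΛ₀| ≤ (u − 1)·m`
  have hml : n * ((ℓL κ Φ t p D g f) : ℤ) - 11 * n + 1 ≤ m := by linarith
  have hbud : u * (N * (2 * U - 2) + n) ≤ (u - 1) * m := by
    have a1 : N * (2 * U - 2) ≤ N * (22 * n) := mul_le_mul_of_nonneg_left (by linarith) hN0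
    have a : N * (2 * U - 2) + n ≤ n * (22 * N + 1) := by linarith
    have b : u * (N * (2 * U - 2) + n) ≤ u * (n * (22 * N + 1)) := mul_le_mul_of_nonneg_left a hu0
    have c1 : n * (25 * N + 2) ≤ n * (((ℓL κ Φ t p D g f) : ℤ) - 11) := mul_le_mul_of_nonneg_left (by linarith) hn0.le
    have c2 : n * (25 * N + 2) ≤ m := by linarith
    have c : (u - 1) * (n * (25 * N + 2)) ≤ (u - 1) * m := mul_le_mul_of_nonneg_left c2 (by linarith)
    have d0 : 33 * N ≤ 3 * u * N := by have := mul_le_mul_of_nonneg_right hu11 hN0; linarith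
    have d1 : n * (u * (22 * N + 1)) ≤ n * ((u - 1) * (25 * N + 2)) := mul_le_mul_of_nonneg_left (by linarith) hn0.le
    linarith
  have hc : |(2 * u * Λ' + m) - (2 * u * Λ + m)| ≤ (u - 1) * (2 * m) := by
    have e2 : (2 * u * Λ' + m) - (2 * u * Λ + m) = 2 * (u * (Λ' - Λ)) := by ring
    rw [e2, abs_mul, abs_of_pos (by norm_num : (0:ℤ) < 2), abs_mul, abs_of_nonneg hu0]
    have := mul_le_mul_of_nonneg_left key' hu0
    linarith
  have := ediv_sub_ediv_abs_le (by linarith : (0:ℤ) < 2 * m) hc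
  linarith

end ShiftY

end KS

end NegB

end PlanarSkeletonFrmQuasi

end Summit.CriticalPhenomena.PercolationContinuityZ3.Theorems.Transplant

end
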